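import Literature.NumberTheory.CubicFields.DavenportHeilbronnMaximalityConverse
import HarnessLib

/-!
# Forms of subrings: `D · f = g ∘ N`, `Disc(f) = D² Disc(g)`, and the maximal overring of a nondegenerate cubic ring

Topic `Literature/NumberTheory/CubicFields`, continuing the Levi–Delone–Faddeev and
Davenport–Heilbronn files (`RingOfForm f`, the index form and `det_toMatrix_one_self_sq`,
`detOnQuot φ` for `φ : R(f) → R(g)`, `IsMaximal`).

Bhargava–Taniguchi–Thorne 2023, §2.1–2.2 (discriminant of a cubic ring; maximal cubic rings;
"Maximality may be checked locally"; §4: `q`-nonmaximal rings have index-`q` overrings and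
`Disc(R) = q² Disc(R')`): if `R ⊆ R'` are cubic rings with index `D` then `Disc(R) = D² Disc(R')`,
and on the forms side `D · f_R = f_{R'} ∘ N` for an integral matrix `N` of determinant `D`. This file
proves these for an arbitrary ring homomorphism `φ : R(f) → R(g)`:

* `RingOfForm.substMatrix φ` — the matrix `N` of `φ` on `R/ℤ·1` (rows: the `(ω, θ)`-coordinates of
  `φ(ω)`, `φ(θ)`), `det N = detOnQuot φ =: D`;
* `RingOfForm.smul_eq_subst` — **`D · f = g ∘ N`** (an identity of integral binary cubic forms; from
  `det[1, φr, φr²]_g = det(φ) · det[1, r, r²]_f` and the index-form identity);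
* `RingOfForm.disc_eq_detOnQuot_sq_mul` — **`Disc(f) = D² · Disc(g)`** for injective `φ` (finite index `|D|`);
* `RingOfForm.surjective_of_isUnit_detOnQuot`, `natAbs_disc_lt` — `φ` is an isomorphism iff
  `D = ±1`; a proper overring has strictly smaller `|Disc|`;
* `RingOfForm.exists_isMaximal_overring` — **every nondegenerate cubic ring `R(f)` (`Disc f ≠ 0`)
  embeds in a maximal cubic ring `R(g)` with `Disc(f) = D² Disc(g)`** (induction on `|Disc|`).

## References

* M. Bhargava, T. Taniguchi, F. Thorne, *Improved error estimates for the Davenport–Heilbronn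
  theorems*, Math. Ann. 389 (2024) = arXiv:2107.12819, §2.1–2.2, §4 [BhargavaTaniguchiThorne2023].
* M. Bhargava, A. Shankar, J. Tsimerman, *On the Davenport–Heilbronn theorems and second order
  terms*, Invent. Math. 193 (2013), §2–3 [BhargavaShankarTsimerman2012].
-/

namespace Literature.NumberTheory.CubicFields

namespace RingOfForm

open BinaryCubic Module

variable {f g : BinaryCubic ℤ} (φ : RingOfForm f →+* RingOfForm g)

/-- The matrix of `φ` on `R/ℤ·1`: rows are the `(ω, θ)`-coordinates of `φ(ω)` and `φ(θ)`; its
determinant is `detOnQuot φ`. [folklore] -/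
def substMatrix : Matrix (Fin 2) (Fin 2) ℤ :=
  !![(φ (omega f)).y, (φ (omega f)).z; (φ (theta f)).y, (φ (theta f)).z]

/-- `det (substMatrix φ) = detOnQuot φ`. [folklore] -/
theorem det_substMatrix : (substMatrix φ).det = detOnQuot φ := by
  rw [substMatrix, Matrix.det_fin_two_of, detOnQuot]; ring

/-- The full matrix of `φ` on `(1, ω, θ)` (columns: coordinates of `φ(1), φ(ω), φ(θ)`), block
triangular with determinant `detOnQuot φ`. [folklore] -/
def fullMatrix : Matrix (Fin 3) (Fin 3) ℤ :=
  !![1, (φ (omega f)).x, (φ (theta f)).x; 0, (φ (omega f)).y, (φ (theta f)).y; 0, (φ (omega f)).z, (φ (theta f)).z]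

/-- `det (fullMatrix φ) = detOnQuot φ`. [folklore] -/
theorem det_fullMatrix : (fullMatrix φ).det = detOnQuot φ := by
  simp [fullMatrix, Matrix.det_fin_three, detOnQuot]

/-- Coordinates transform by `fullMatrix`: the coordinate matrix of `(1, φ r, φ r²)` on `(1, ω_g, θ_g)`
is `fullMatrix φ` times that of `(1, r, r²)` on `(1, ω_f, θ_f)`. [folklore] -/
theorem toMatrix_apply_eq_fullMatrix_mul (r : RingOfForm f) :
    (basis g).toMatrix ![1, φ r, φ (r * r)] = fullMatrix φ * (basis f).toMatrix ![1, r, r * r] := by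
  have hx := ringHom_apply_x φ r
  have hy := ringHom_apply_y φ r
  have hz := ringHom_apply_z φ r
  have hx2 := ringHom_apply_x φ (r * r)
  have hy2 := ringHom_apply_y φ (r * r)
  have hz2 := ringHom_apply_z φ (r * r)
  ext i j
  fin_cases i <;> fin_cases j <;>
    simp [-map_mul, Basis.toMatrix_apply, Matrix.mul_apply, Fin.sum_univ_three, fullMatrix, hx, hy, hz, hx2, hy2, hz2]
  all_goals ring

/-- **`D · f = g ∘ N`**: for any ring homomorphism `φ : R(f) → R(g)`, with `N = substMatrix φ` and
`D = detOnQuot φ = det N`, the form `g` composed with `N` is `D` times `f` — on the level of values,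
`g((x, y) N) = D · f(x, y)`: the index form of the sublattice `φ(R(f)) ⊆ R(g)` (BTT §2.1–2.2 / §4,
the relation between the forms of a cubic ring and of an overring). [cite: BhargavaTaniguchiThorne2023, §4 (forms of a cubic ring and of its index-q overring)] -/
theorem smul_eq_subst : detOnQuot φ • f = g.subst (substMatrix φ) := by
  apply eq_of_eval_eq
  intro x y
  -- the two index-form identities for `r = xω + yθ` and `φ r`, and the change of coordinates
  have hf := det_toMatrix_one_self_sq (basis f) basis_zero (⟨0, x, y⟩ : RingOfForm f)
  have hg := det_toMatrix_one_self_sq (basis g) basis_zero (φ (⟨0, x, y⟩ : RingOfForm f))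
  rw [indexForm_basis] at hf hg
  simp only [basis_repr_apply, Matrix.cons_val_zero, Matrix.cons_val_one, Matrix.cons_val_two, Matrix.head_cons,
    Matrix.tail_cons] at hf hg
  rw [← map_mul, toMatrix_apply_eq_fullMatrix_mul, Matrix.det_mul, det_fullMatrix, hf] at hg
  -- `hg : D * (−f(x, y)) = −g((φ r).y, (φ r).z)`
  have hry : (φ (⟨0, x, y⟩ : RingOfForm f)).y = x * (φ (omega f)).y + y * (φ (theta f)).y := by
    rw [ringHom_apply_y]
  have hrz : (φ (⟨0, x, y⟩ : RingOfForm f)).z = x * (φ (omega f)).z + y * (φ (theta f)).z := by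
    rw [ringHom_apply_z]
  rw [eval_smul, eval_subst]
  simp only [substMatrix, Matrix.of_apply, Matrix.cons_val', Matrix.cons_val_zero, Matrix.cons_val_one,
    Matrix.cons_val_fin_one, Matrix.empty_val']
  rw [← hry, ← hrz]
  linarith

/-- **`D⁴ Disc(f) = D⁶ Disc(g)`** for any ring homomorphism `φ : R(f) → R(g)` (`Disc` is quartic in
the form and `Disc(g ∘ N) = (det N)⁶ Disc(g)`). [folklore] -/
theorem detOnQuot_pow_four_mul_disc : detOnQuot φ ^ 4 * f.disc = detOnQuot φ ^ 6 * g.disc := by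
  rw [← disc_smul, smul_eq_subst, disc_subst, det_substMatrix]

/-- **`Disc(f) = D² Disc(g)`** for an injective `φ : R(f) ↪ R(g)` (`D = detOnQuot φ ≠ 0` is, up to
sign, the index of `φ(R(f))` in `R(g)`; BTT 2023, §2.1/§4: `Disc(R) = [R' : R]² Disc(R')`). [cite: BhargavaTaniguchiThorne2023, §4 (Disc of a subring of index q is q² Disc)] -/
theorem disc_eq_detOnQuot_sq_mul (hφ : Function.Injective φ) : f.disc = detOnQuot φ ^ 2 * g.disc := by
  have hD := detOnQuot_ne_zero hφ
  have h := detOnQuot_pow_four_mul_disc φ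
  have h' : detOnQuot φ ^ 4 * f.disc = detOnQuot φ ^ 4 * (detOnQuot φ ^ 2 * g.disc) := by rw [h]; ring
  exact mul_left_cancel₀ (pow_ne_zero 4 hD) h'

/-- `φ` is surjective when `detOnQuot φ = ±1` (the cokernel is killed by `D`). [folklore] -/
theorem surjective_of_isUnit_detOnQuot (hu : IsUnit (detOnQuot φ)) : Function.Surjective φ := by
  intro y
  obtain ⟨r, hr⟩ := exists_eq_detOnQuot_mul φ y
  rcases Int.isUnit_iff.mp hu with h1 | h1
  · exact ⟨r, by rw [hr, h1, Int.cast_one, one_mul]⟩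
  · exact ⟨-r, by rw [map_neg, hr, h1, Int.cast_neg, Int.cast_one]; ring⟩

/-- A proper overring has strictly smaller `|Disc|` (and divides it): if `φ : R(f) ↪ R(g)` is
injective and not surjective then `|Disc g| < |Disc f|` (for `Disc f ≠ 0`). [folklore] -/
theorem natAbs_disc_lt (hφ : Function.Injective φ) (hns : ¬ Function.Surjective φ) (h0 : f.disc ≠ 0) :
    g.disc.natAbs < f.disc.natAbs := by
  have hnu : ¬ IsUnit (detOnQuot φ) := fun hu => hns (surjective_of_isUnit_detOnQuot φ hu)
  have hD := detOnQuot_ne_zero hφ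
  have hdisc := disc_eq_detOnQuot_sq_mul φ hφ
  have hg0 : g.disc ≠ 0 := by
    intro h; apply h0; rw [hdisc, h, mul_zero]
  rw [hdisc, Int.natAbs_mul, Int.natAbs_pow]
  have h2 : 2 ≤ (detOnQuot φ).natAbs := by
    rw [Int.isUnit_iff_natAbs_eq] at hnu
    have := Int.natAbs_pos.mpr hD
    omega
  have hg1 : 0 < g.disc.natAbs := Int.natAbs_pos.mpr hg0
  have h4 : 1 < (detOnQuot φ).natAbs ^ 2 := by nlinarith
  calc g.disc.natAbs = 1 * g.disc.natAbs := (one_mul _).symm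
    _ < (detOnQuot φ).natAbs ^ 2 * g.disc.natAbs := Nat.mul_lt_mul_of_pos_right h4 hg1

/-- The discriminant of an overring divides the discriminant and has the same sign. [folklore] -/
theorem disc_dvd_of_injective (hφ : Function.Injective φ) : g.disc ∣ f.disc :=
  ⟨detOnQuot φ ^ 2, by rw [disc_eq_detOnQuot_sq_mul φ hφ, mul_comm]⟩

/-- The discriminant of an overring has the same sign. [folklore] -/
theorem disc_pos_iff_of_injective (hφ : Function.Injective φ) : 0 < g.disc ↔ 0 < f.disc := by
  have hD2 : 0 < detOnQuot φ ^ 2 := by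
    have := detOnQuot_ne_zero hφ
    positivity
  rw [disc_eq_detOnQuot_sq_mul φ hφ]
  constructor
  · intro h; positivity
  · intro h; exact pos_of_mul_pos_right h hD2.le

variable {φ}

/-- **Every nondegenerate cubic ring embeds in a maximal cubic ring**: if `Disc(f) ≠ 0` there is a
maximal `R(g)` and an injective ring homomorphism `R(f) ↪ R(g)` (then `Disc(f) = D² Disc(g)`,
`disc_eq_detOnQuot_sq_mul`). Induction on `|Disc(f)|`: a non-maximal `R(f)` has a proper overring,
which has strictly smaller `|Disc|` (BTT 2023, §2.1: maximal orders / maximal cubic rings). [cite: BhargavaTaniguchiThorne2023, §2.1 (every cubic ring is contained in a maximal cubic ring)] -/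
theorem exists_isMaximal_overring {f : BinaryCubic ℤ} (h0 : f.disc ≠ 0) :
    ∃ g : BinaryCubic ℤ, IsMaximal g ∧ ∃ φ : RingOfForm f →+* RingOfForm g, Function.Injective φ := by
  induction hn : f.disc.natAbs using Nat.strong_induction_on generalizing f with
  | _ n ih =>
    by_cases hmax : IsMaximal f
    · exact ⟨f, hmax, RingHom.id _, fun _ _ h => h⟩
    · simp only [IsMaximal, not_forall] at hmax
      obtain ⟨g, φ, hφ, hns⟩ := hmax
      have hlt := natAbs_disc_lt φ hφ hns h0
      have hg0 : g.disc ≠ 0 := by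
        intro h; apply h0; rw [disc_eq_detOnQuot_sq_mul φ hφ, h, mul_zero]
      obtain ⟨k, hk, ψ, hψ⟩ := ih g.disc.natAbs (hn ▸ hlt) hg0 rfl
      exact ⟨k, hk, ψ.comp φ, hψ.comp hφ⟩

end RingOfForm

end Literature.NumberTheory.CubicFields
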